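import Literature.AnabelianGeometry.SemiGraphs.CoveringGraphGaloisFibreActions
import Literature.AnabelianGeometry.SemiGraphs.TemperedEdgeLikeCommensurableRigidity
import Literature.AnabelianGeometry.SemiGraphs.SpecialFibreTowerOfCoverings
import Literature.AnabelianGeometry.SemiGraphs.TemperedCompactInVerticialFinite
import HarnessLib

/-!
# [SemiAnbd] Example 3.10: `Δ` ACTS ON THE SEMI-GRAPHS `𝔾_i` — one special-fibre tower over `π₁^temp(𝒢)` with, at
# every level, a homomorphism `ρ_i : Δ →* Aut(𝔾_i)` into the automorphisms of the underlying SEMI-GRAPH of the fibre,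
# over `𝔾`, through `Δ/N_i`, fibre-transitive, whose vertex and edge parts obey the dictionary laws

Mochizuki, *Semi-graphs of anabelioids*, Publ. RIMS **42** (2006), §3, Example 3.10, manuscript p. 44 l. 12–17
[cite: MochizukiSemiAnbd2006, Ex 3.10 p.44] ("we obtain a sequence of finite, log étale Galois coverings … semi-graphs
of anabelioids `𝒢_i`, `𝒢^c_i` on which `Δ_i` acts faithfully"), Def. 3.5 (i) p. 37, Thm. 3.7 pp. 40–41;
[IUTchI] proof of Prop. 2.4 (i) p. 50 [cite: Mochizuki2012, Prop 2.4(i) p.50] ("the action of `Π^tp_X` on `𝔾_J`").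

PROOF-ONLY file (abc-iut cell, layer L3, seat abc-iut-L3-t2 gen 5, row «Ex310-GRAPH-ACTION», part H; no definition,
no instance, no new named fact), the assembly of `CoveringGraphGaloisFibreActions.lean`:
* `CovObj.exists_galois_graphAction` — for a Galois connected tempered `S` (stabiliser `U` normal): a homomorphism
  `ρ : Π →* Aut(𝔾_S)` into the automorphism group of the underlying semi-graph of `𝒢_S` (vertices `(v, σ_v(g)ω)`,
  edges `(e, τ_e(g)ω)`, branches `(b, τ_e(g)ω)` — a morphism of semi-graphs by the INCIDENCE LAW), over `𝔾`, with
  the dictionary laws for its vertex and edge parts, fibre-transitive, trivial on `U`;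
* `SpecialFibreTower.exists_of_coverings_graphAction` — ONE tower `T` over `π₁^temp(𝒢)` (levels `N`, fibres
  `𝒢_{S_i}`, admissible kernels `1`, as in `SpecialFibreTower.exists_of_coverings`) carrying, for every `i`, the
  structure map `π_i : 𝔾_i ⟶ 𝔾` and `ρ_i : Δ →* Aut(𝔾_i)` with `ρ_i(g) ≫ π_i = π_i`, the vertex/edge dictionaries
  and the dictionary laws of the vertex/edge parts of `ρ_i(g)` on the `T.adm i`-traces (the shape of the laws
  `actGraph_vertexMap` / `proj_actGraph` of the origin record `SpecialFibreTower.PiData`), fibre-transitivity, and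
  `N_i ≤ ker ρ_i`.
Hypothesis beyond Thm. 3.7 + strict coherence: Thm. 3.7 (iii) AT `𝒢` (`CompactInVerticialAt 𝒢`, a theorem for finite
`𝒢`); the commensurable rigidity `hCT` of edge-like subgroups required by the edge half is DISCHARGED from it
(`edgeLike_commensurable_rigid_of_compactInVerticialAt`, every edge, cusps included).  This supersedes the HONEST
LIMITS «incidence of (σ, τ) not treated» and «hCT open for cusps» of `SpecialFibreTowerOfCoveringsFibres.lean`.  Nothing here is about curves (the identification
of `Δ = π₁^temp(𝒢)` with a quotient of `Δ^temp_X` stays an origin statement); no side is taken on [IUTchIII] Cor. 3.12.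
-/

noncomputable section

open CategoryTheory Topology

namespace Literature.AnabelianGeometry.SemiGraphs

open Literature.AlgebraicGeometry.Frobenioids (IsSlimGroup IsConnectedObj)
open Literature.AlgebraicGeometry.Frobenioids.QuasiTemperoid.BTempConnected (isConnectedObj_of_transitive)
open ProfiniteSemiGraph

universe u

/-- Transport of `φ : U ⥲ π₁^temp(𝒢_S)` along `U = N`, remembering its effect on traces. [folklore] -/
private theorem exists_adm_of_eq''' {G H : Type u} [Group G] [TopologicalSpace G] [Group H] [TopologicalSpace H]
    {U N : Subgroup G} (hUN : U = N) (φ : U →ₜ* H) (hφ : Function.Surjective φ) (hφo : IsOpenMap φ)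
    (hker : φ.toMonoidHom.ker = ⊥) :
    ∃ ψ : N →ₜ* H, Function.Surjective ψ ∧ IsOpenMap ψ ∧ ψ.toMonoidHom.ker = ⊥ ∧
      ∀ K : Subgroup G, (K.subgroupOf N).map ψ.toMonoidHom = (K.subgroupOf U).map φ.toMonoidHom := by
  subst hUN; exact ⟨φ, hφ, hφo, hker, fun _ => rfl⟩

namespace ProfiniteSemiGraph

namespace CovObj

variable {𝒢 : ProfiniteSemiGraph.{u}} (S : CovObj 𝒢)

/-- **[SemiAnbd] Ex. 3.10 / Def. 3.5 (i) — `Π` acts on the semi-graph `𝔾_S` of a Galois `𝒢_S`, over `𝔾`.**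
See the module docstring. [cite: MochizukiSemiAnbd2006, Ex 3.10 p.44] -/
theorem exists_galois_graphAction (h37 : 𝒢.Thm37Hypotheses) (hsc : 𝒢.IsStrictlyCoherent)
    (hCV : CompactInVerticialAt 𝒢) (c : TemperedPiChart 𝒢) (hS : S.IsTempered) (hSc : IsConnectedObj (⟨S, hS⟩ : BTempCat 𝒢)) (cS : TemperedPiChart S.coveringGraph)
    (ω₀ : BTemp.Orbits (c.equiv.functor.obj ⟨S, hS⟩))
    (φ : BTemp.stab (c.equiv.functor.obj ⟨S, hS⟩) (Quot.out ω₀) →ₜ* cS.G)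
    (hφ : Nonempty (cS.equiv.inverse ⋙
          (S.etaleEquiv uniformSplitting_holds h37.toProp36Hypotheses hsc.isCoherent hS).functor ⋙
          (Over.postEquiv (⟨S, hS⟩ : BTempCat 𝒢) c.equiv).functor ⋙
          BTemp.fibreFamily (c.equiv.functor.obj ⟨S, hS⟩) ⋙
          Pi.eval (fun ω => BTemp (BTemp.stab (c.equiv.functor.obj ⟨S, hS⟩) (Quot.out ω))) ω₀ ≅
        BTemp.res φ))
    (hφb : Function.Bijective φ) (hU : (BTemp.stab (c.equiv.functor.obj ⟨S, hS⟩) (Quot.out ω₀)).Normal) :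
    ∃ ρ : c.G →* Aut S.coveringSemiGraph,
      (∀ (g : c.G) (x : S.coveringSemiGraph.Vertex), ((ρ g).hom.vertexMap x).1 = x.1) ∧
      (∀ (g : c.G) (y : S.coveringSemiGraph.Edge), ((ρ g).hom.edgeMap y).1 = y.1) ∧
      (∀ (g : c.G) (β : S.coveringSemiGraph.Branch), ((ρ g).hom.branchMap β).1 = β.1) ∧
      (∀ (g : c.G) (x : S.coveringSemiGraph.Vertex) (K : Subgroup c.G), K ∈ verticialSubgroups c x.1 →
        (K.subgroupOf (BTemp.stab (c.equiv.functor.obj ⟨S, hS⟩) (Quot.out ω₀))).map φ.toMonoidHom ∈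
          verticialSubgroups cS x →
        ((K.map (MulAut.conj g).toMonoidHom).subgroupOf
            (BTemp.stab (c.equiv.functor.obj ⟨S, hS⟩) (Quot.out ω₀))).map φ.toMonoidHom ∈
          verticialSubgroups cS ((ρ g).hom.vertexMap x)) ∧
      (∀ x₁ x₂ : S.coveringSemiGraph.Vertex, x₁.1 = x₂.1 → ∃ g, (ρ g).hom.vertexMap x₁ = x₂) ∧
      (∀ (g : c.G) (y : S.coveringSemiGraph.Edge) (L : Subgroup c.G), L ∈ edgeLikeSubgroups c y.1 →
        (L.subgroupOf (BTemp.stab (c.equiv.functor.obj ⟨S, hS⟩) (Quot.out ω₀))).map φ.toMonoidHom ∈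
          edgeLikeSubgroups cS y →
        ((L.map (MulAut.conj g).toMonoidHom).subgroupOf
            (BTemp.stab (c.equiv.functor.obj ⟨S, hS⟩) (Quot.out ω₀))).map φ.toMonoidHom ∈
          edgeLikeSubgroups cS ((ρ g).hom.edgeMap y)) ∧
      (∀ y₁ y₂ : S.coveringSemiGraph.Edge, y₁.1 = y₂.1 → ∃ g, (ρ g).hom.edgeMap y₁ = y₂) ∧
      (∀ n ∈ BTemp.stab (c.equiv.functor.obj ⟨S, hS⟩) (Quot.out ω₀), ρ n = 1) := by
  obtain ⟨σ, τ, hVlaw, hVtr, hVU, hElaw, hEtr, hEU, hinc⟩ :=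
    S.exists_galois_fibreActions h37 hsc hCV c (edgeLike_commensurable_rigid_of_compactInVerticialAt hCV h37 c)
      hS hSc cS ω₀ φ hφ hφb hU
  -- the morphism of semi-graphs attached to `g`
  let A : c.G → (S.coveringSemiGraph ⟶ S.coveringSemiGraph) := fun g =>
    { vertexMap := fun x => ⟨x.1, σ x.1 g x.2⟩
      edgeMap := fun y => ⟨y.1, τ y.1 g y.2⟩
      branchMap := fun β => ⟨β.1, τ (𝒢.graph.edgeOf β.1) g β.2⟩
      edgeOf_branchMap := fun _ => rfl
      branchMap_injOn := by
        rintro ⟨b₁, ω₁⟩ ⟨b₂, ω₂⟩ _ hβ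
        obtain ⟨rfl, h2⟩ := Sigma.mk.inj hβ
        exact Sigma.ext rfl (heq_of_eq ((τ _ g).injective (eq_of_heq h2)))
      abuts_branchMap := by
        rintro ⟨b, ω⟩ ⟨v, ωv⟩ h
        have hb := S.abuts_of_coveringAbuts h
        have hωv := S.glueOrbit_eq_of_coveringAbuts h
        show S.coveringSemiGraph.abuts ⟨b, τ _ g ω⟩ = some ⟨v, σ v g ωv⟩
        rw [S.coveringAbuts_eq hb, ← hωv, hinc g hb ω] }
  have hA1 : A 1 = 𝟙 _ := by
    refine SemiGraph.hom_ext _ _ (funext fun x => ?_) (funext fun y => ?_) (funext fun β => ?_)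
    · show (⟨x.1, σ x.1 1 x.2⟩ : S.coveringSemiGraph.Vertex) = x
      rw [map_one]; rfl
    · show (⟨y.1, τ y.1 1 y.2⟩ : S.coveringSemiGraph.Edge) = y
      rw [map_one]; rfl
    · show (⟨β.1, τ _ 1 β.2⟩ : S.coveringSemiGraph.Branch) = β
      rw [map_one]; rfl
  have hAmul : ∀ g h, A (g * h) = A h ≫ A g := fun g h => by
    refine SemiGraph.hom_ext _ _ (funext fun x => ?_) (funext fun y => ?_) (funext fun β => ?_)
    · show (⟨x.1, σ x.1 (g * h) x.2⟩ : S.coveringSemiGraph.Vertex) = ⟨x.1, σ x.1 g (σ x.1 h x.2)⟩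
      rw [map_mul]; rfl
    · show (⟨y.1, τ y.1 (g * h) y.2⟩ : S.coveringSemiGraph.Edge) = ⟨y.1, τ y.1 g (τ y.1 h y.2)⟩
      rw [map_mul]; rfl
    · show (⟨β.1, τ _ (g * h) β.2⟩ : S.coveringSemiGraph.Branch) = ⟨β.1, τ _ g (τ _ h β.2)⟩
      rw [map_mul]; rfl
  let ρ : c.G →* Aut S.coveringSemiGraph :=
    { toFun := fun g =>
        { hom := A g
          inv := A g⁻¹
          hom_inv_id := by rw [← hAmul, inv_mul_cancel, hA1]
          inv_hom_id := by rw [← hAmul, mul_inv_cancel, hA1] }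
      map_one' := Aut.ext hA1
      map_mul' := fun g h => Aut.ext (by rw [Aut.Aut_mul_def]; exact hAmul g h) }
  refine ⟨ρ, fun _ _ => rfl, fun _ _ => rfl, fun _ _ => rfl, ?_, ?_, ?_, ?_, ?_⟩
  · rintro g ⟨v, ω⟩ K hK hKx
    exact hVlaw g v ω K hK hKx
  · rintro ⟨v, ω₁⟩ ⟨v', ω₂⟩ hvv
    change v = v' at hvv
    subst hvv
    obtain ⟨g, hg⟩ := hVtr v ω₁ ω₂
    exact ⟨g, show (⟨v, σ v g ω₁⟩ : S.coveringSemiGraph.Vertex) = ⟨v, ω₂⟩ by rw [hg]⟩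
  · rintro g ⟨e, ω⟩ L hL hLy
    exact hElaw g e ω L hL hLy
  · rintro ⟨e, ω₁⟩ ⟨e', ω₂⟩ hee
    change e = e' at hee
    subst hee
    obtain ⟨g, hg⟩ := hEtr e ω₁ ω₂
    exact ⟨g, show (⟨e, τ e g ω₁⟩ : S.coveringSemiGraph.Edge) = ⟨e, ω₂⟩ by rw [hg]⟩
  · intro n hn
    refine Aut.ext (SemiGraph.hom_ext _ _ (funext fun x => ?_) (funext fun y => ?_) (funext fun β => ?_))
    · show (⟨x.1, σ x.1 n x.2⟩ : S.coveringSemiGraph.Vertex) = x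
      rw [hVU x.1 n hn]; rfl
    · show (⟨y.1, τ y.1 n y.2⟩ : S.coveringSemiGraph.Edge) = y
      rw [hEU y.1 n hn]; rfl
    · show (⟨β.1, τ _ n β.2⟩ : S.coveringSemiGraph.Branch) = β
      rw [hEU _ n hn]; rfl

end CovObj

end ProfiniteSemiGraph

/-! ### The tower -/

namespace SpecialFibreTower

variable {𝒢 : ProfiniteSemiGraph.{u}}

/-- **[SemiAnbd] Example 3.10 — one tower over `π₁^temp(𝒢)` on whose fibres `𝔾_i` the group `Δ` ACTS BY
AUTOMORPHISMS OF SEMI-GRAPHS over `𝔾`, through `Δ/N_i`, transitively on the fibres.**  See the module docstring for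
the list of clauses. [cite: MochizukiSemiAnbd2006, Ex 3.10 p.44] -/
theorem exists_of_coverings_graphAction (h37 : 𝒢.Thm37Hypotheses) (hsc : 𝒢.IsStrictlyCoherent)
    (hCV : CompactInVerticialAt 𝒢) (c : TemperedPiChart 𝒢) (N : ℕ → Subgroup c.G) (hanti : Antitone N) (hopen : ∀ i, IsOpen (N i : Set c.G))
    (hchar : ∀ (i) (φ : c.G ≃ₜ* c.G), (N i).map φ.toMulEquiv.toMonoidHom = N i)
    (hnormal : ∀ i, (N i).Normal) (hfi : ∀ i, (N i).FiniteIndex) (hexh : ∀ g : c.G, (∀ i, g ∈ N i) → g = 1) :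
    ∃ T : SpecialFibreTower c.G, T.N = N ∧ (∀ i, T.admKer i = ⊥) ∧
      ∀ i, ∃ (S : CovObj 𝒢) (hS : S.IsTempered) (_ : T.Gc i = S.coveringGraph)
        (π : (T.Gc i).graph ⟶ 𝒢.graph) (ρ : c.G →* Aut (T.Gc i).graph),
        IsConnectedObj (⟨S, hS⟩ : BTempCat 𝒢) ∧ (∀ g, (ρ g).hom ≫ π = π) ∧
        Function.Surjective π.vertexMap ∧ Function.Surjective π.edgeMap ∧
        -- vertices: dictionary
        (∀ x, ∃ K ∈ verticialSubgroups c (π.vertexMap x),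
          (K.subgroupOf (T.N i)).map (T.adm i).toMonoidHom ∈ verticialSubgroups (T.chart i) x) ∧
        (∀ x (H : Subgroup (T.chart i).G), H ∈ verticialSubgroups (T.chart i) x →
          ∃ K ∈ verticialSubgroups c (π.vertexMap x), H = (K.subgroupOf (T.N i)).map (T.adm i).toMonoidHom) ∧
        (∀ (v : 𝒢.graph.Vertex) (K : Subgroup c.G) x, K ∈ verticialSubgroups c v →
          (K.subgroupOf (T.N i)).map (T.adm i).toMonoidHom ∈ verticialSubgroups (T.chart i) x →
          π.vertexMap x = v) ∧
        -- vertices: the action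
        (∀ g x (K : Subgroup c.G), K ∈ verticialSubgroups c (π.vertexMap x) →
          (K.subgroupOf (T.N i)).map (T.adm i).toMonoidHom ∈ verticialSubgroups (T.chart i) x →
          ((K.map (MulAut.conj g).toMonoidHom).subgroupOf (T.N i)).map (T.adm i).toMonoidHom ∈
            verticialSubgroups (T.chart i) ((ρ g).hom.vertexMap x)) ∧
        (∀ x₁ x₂, π.vertexMap x₁ = π.vertexMap x₂ → ∃ g, (ρ g).hom.vertexMap x₁ = x₂) ∧
        -- edges: dictionary
        (∀ y, ∃ L ∈ edgeLikeSubgroups c (π.edgeMap y),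
          (L.subgroupOf (T.N i)).map (T.adm i).toMonoidHom ∈ edgeLikeSubgroups (T.chart i) y) ∧
        (∀ y (H : Subgroup (T.chart i).G), H ∈ edgeLikeSubgroups (T.chart i) y →
          ∃ L ∈ edgeLikeSubgroups c (π.edgeMap y), H = (L.subgroupOf (T.N i)).map (T.adm i).toMonoidHom) ∧
        (∀ (e : 𝒢.graph.Edge) (L : Subgroup c.G) y, L ∈ edgeLikeSubgroups c e →
          (L.subgroupOf (T.N i)).map (T.adm i).toMonoidHom ∈ edgeLikeSubgroups (T.chart i) y → π.edgeMap y = e) ∧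
        -- edges: the action
        (∀ g y (L : Subgroup c.G), L ∈ edgeLikeSubgroups c (π.edgeMap y) →
          (L.subgroupOf (T.N i)).map (T.adm i).toMonoidHom ∈ edgeLikeSubgroups (T.chart i) y →
          ((L.map (MulAut.conj g).toMonoidHom).subgroupOf (T.N i)).map (T.adm i).toMonoidHom ∈
            edgeLikeSubgroups (T.chart i) ((ρ g).hom.edgeMap y)) ∧
        (∀ y₁ y₂, π.edgeMap y₁ = π.edgeMap y₂ → ∃ g, (ρ g).hom.edgeMap y₁ = y₂) ∧
        (∀ n ∈ T.N i, ρ n = 1) := by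
  classical
  haveI := c.secondCountableTopology; haveI := c.isTopologicalGroup
  have h36 : 𝒢.Prop36Hypotheses := h37.toProp36Hypotheses; have hcoh : 𝒢.IsCoherent := hsc.isCoherent
  have hslim : IsSlimGroup c.G := temperedPiSlim_holds 𝒢 h36 c
  have hED : EdgeLikeDistinctAt 𝒢 := edgeLikeDistinctAt_of_compactInVerticialAt hCV
  let Q : ℕ → BTemp c.G := fun i =>
    ⟨Action.ofMulAction c.G (c.G ⧸ N i), (temperedAction_quotient_iff c.isTempered (N i)).mpr (hopen i)⟩
  have hQconn : ∀ i, IsConnectedObj (Q i) := fun i => by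
    refine isConnectedObj_of_transitive (Q i) (QuotientGroup.mk 1 : c.G ⧸ N i) fun x => ?_
    induction x using QuotientGroup.induction_on with
    | H z => exact ⟨z, by
        change z • (QuotientGroup.mk 1 : c.G ⧸ N i) = QuotientGroup.mk z
        rw [MulAction.Quotient.smul_mk, smul_eq_mul, mul_one]⟩
  have key : ∀ i, ∃ (S : CovObj 𝒢) (hS : S.IsTempered) (hSc : IsConnectedObj (⟨S, hS⟩ : BTempCat 𝒢))
      (cS : TemperedPiChart S.coveringGraph) (ω₀ : BTemp.Orbits (c.equiv.functor.obj ⟨S, hS⟩))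
      (φ : BTemp.stab (c.equiv.functor.obj ⟨S, hS⟩) (Quot.out ω₀) →ₜ* cS.G),
      Nonempty (cS.equiv.inverse ⋙ (S.etaleEquiv uniformSplitting_holds h36 hcoh hS).functor ⋙
          (Over.postEquiv (⟨S, hS⟩ : BTempCat 𝒢) c.equiv).functor ⋙
          BTemp.fibreFamily (c.equiv.functor.obj ⟨S, hS⟩) ⋙
          Pi.eval (fun ω => BTemp (BTemp.stab (c.equiv.functor.obj ⟨S, hS⟩) (Quot.out ω))) ω₀ ≅
        BTemp.res φ) ∧
      Function.Bijective φ ∧ IsOpenMap φ ∧ BTemp.stab (c.equiv.functor.obj ⟨S, hS⟩) (Quot.out ω₀) = N i := by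
    intro i
    let Sobj : BTempCat 𝒢 := c.equiv.inverse.obj (Q i)
    have hSc : IsConnectedObj Sobj := TemperoidTransport.isConnectedObj_functor_obj c.equiv.symm (hQconn i)
    let S : CovObj 𝒢 := Sobj.obj
    have hS : S.IsTempered := Sobj.property; have hSc' : IsConnectedObj (⟨S, hS⟩ : BTempCat 𝒢) := hSc
    let iso : c.equiv.functor.obj ⟨S, hS⟩ ≅ Q i := c.equiv.counitIso.app (Q i)
    let cS : TemperedPiChart S.coveringGraph :=
      S.coveringGraph.temperedPiChart (S.thm37Hypotheses_coveringGraph h37 hsc hS hSc').toProp36Hypotheses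
    let x₀ : (c.equiv.functor.obj ⟨S, hS⟩).obj.V := iso.inv.hom.hom (QuotientGroup.mk 1 : c.G ⧸ N i)
    let ω₀ : BTemp.Orbits (c.equiv.functor.obj ⟨S, hS⟩) := BTemp.cl _ x₀
    obtain ⟨φ, ψ, hψφ, hφψ, hcompat⟩ := CovObj.exists_chartGroup_compatIso h36 hcoh c S hS hSc' cS ω₀
    haveI := hnormal i
    have hUN : BTemp.stab (c.equiv.functor.obj ⟨S, hS⟩) (Quot.out ω₀) = N i := by
      ext g; rw [BTemp.mem_stab_iff_of_iso iso, BTemp.stab_quotient_eq c.isTempered (N i) (hopen i)]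
    have hopenφ : IsOpenMap φ := Homeomorph.isOpenMap
      { toFun := φ, invFun := ψ, left_inv := hψφ, right_inv := hφψ,
        continuous_toFun := φ.continuous, continuous_invFun := ψ.continuous }
    exact ⟨S, hS, hSc', cS, ω₀, φ, hcompat, ⟨Function.LeftInverse.injective hψφ, fun y => ⟨ψ y, hφψ y⟩⟩,
      hopenφ, hUN⟩
  choose S hS hSc cS ω₀ φ hφ hφb hφo hUN using key
  have hadm : ∀ i, ∃ ψ : N i →ₜ* (cS i).G, Function.Surjective ψ ∧ IsOpenMap ψ ∧ ψ.toMonoidHom.ker = ⊥ ∧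
      ∀ K : Subgroup c.G, (K.subgroupOf (N i)).map ψ.toMonoidHom =
        (K.subgroupOf (BTemp.stab (c.equiv.functor.obj ⟨S i, hS i⟩) (Quot.out (ω₀ i)))).map
          (φ i).toMonoidHom := fun i =>
    exists_adm_of_eq''' (hUN i) (φ i) (hφb i).2 (hφo i) ((MonoidHom.ker_eq_bot_iff _).mpr (hφb i).1)
  choose adm hsurj hopenMap hker hadmK using hadm
  refine ⟨{ N := N, N_antitone := hanti, isOpen_N := hopen, N_char := hchar, N_normal := hnormal,
            N_finiteIndex := hfi, N_exhaustive := hexh, Gc := fun i => (S i).coveringGraph,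
            hyp := fun i => (S i).thm37Hypotheses_coveringGraph h37 hsc (hS i) (hSc i),
            chart := fun i => cS i, admKer := fun _ => ⊥, admKer_le := fun _ => bot_le,
            admKer_normal := fun _ => inferInstance, admKer_antitone := fun _ _ _ => le_rfl,
            adm := adm, adm_surjective := hsurj, isOpenMap_adm := hopenMap,
            ker_adm := fun i => by rw [hker i, Subgroup.bot_subgroupOf]
            faithful := fun i g hg => ?_ }, rfl, fun _ => rfl, fun i => ?_⟩
  · have hz : g ∈ Subgroup.centralizer (N i : Set c.G) := by
      rw [Subgroup.mem_centralizer_iff]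
      intro n hn
      have h := hg n hn; rw [Subgroup.mem_bot] at h
      calc n * g = 1 * (n * g) := (one_mul _).symm
        _ = g * n * g⁻¹ * n⁻¹ * (n * g) := by rw [h]
        _ = g * n := by group
    rw [hslim.centralizer_eq_bot _ (hopen i), Subgroup.mem_bot] at hz
    rw [hz]; exact (N i).one_mem
  · -- level `i`
    have hU : (BTemp.stab (c.equiv.functor.obj ⟨S i, hS i⟩) (Quot.out (ω₀ i))).Normal := by
      rw [hUN i]; exact hnormal i
    obtain ⟨ρ, hR1, hR2, hR3, hVlaw, hVtr, hElaw, hEtr, hρU⟩ :=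
      (S i).exists_galois_graphAction h37 hsc hCV c (hS i) (hSc i) (cS i) (ω₀ i) (φ i) (hφ i) (hφb i) hU
    refine ⟨S i, hS i, rfl, (S i).coveringHom.base, ρ, hSc i, fun g => ?_, ?_, ?_,
      ?_, ?_, ?_, ?_, ?_, ?_, ?_, ?_, ?_, ?_, ?_⟩
    · exact SemiGraph.hom_ext _ _ (funext fun x => hR1 g x) (funext fun y => hR2 g y) (funext fun β => hR3 g β)
    · intro v
      obtain ⟨χ₀, hχ₀⟩ := exists_isVerticialHom h36.isQuasiCoherent h36.isGaloisCountable c v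
      obtain ⟨ω, -⟩ := (S i).exists_isVerticialHom_coveringGraph h36 hcoh c (hS i) (cS i) (ω₀ i) (φ i) (hφ i)
        v χ₀ hχ₀
      exact ⟨⟨v, ω⟩, rfl⟩
    · intro e
      obtain ⟨v₀⟩ := h36.hasVertex
      obtain ⟨b, hbe, hb⟩ := SemiGraph.exists_abuts_of_isConnected h36.isConnected v₀ e
      obtain ⟨v, hv⟩ := Option.isSome_iff_exists.mp hb
      subst hbe
      obtain ⟨χ₀, hχ₀⟩ := exists_isEdgeHom h36.isQuasiCoherent h36.isGaloisCountable h36.isOfInjectiveType c b v hv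
      obtain ⟨ω, -⟩ := (S i).exists_isEdgeHom_coveringGraph h36 hcoh c (hS i) (cS i) (ω₀ i) (φ i) (hφ i) _ χ₀ hχ₀
      exact ⟨⟨_, ω⟩, rfl⟩
    · rintro ⟨v, ω⟩
      obtain ⟨K, hK, h⟩ := (S i).exists_trace_mem_verticialSubgroups h36 hcoh c (hS i) (hSc i) (cS i) (ω₀ i) (φ i)
        (hφ i) v ω
      exact ⟨K, hK, by rw [hadmK]; exact h⟩
    · rintro ⟨v, ω⟩ H hH
      obtain ⟨K, hK, hHK⟩ := (S i).exists_trace_eq_of_mem_verticialSubgroups h36 hcoh c (hS i) (hSc i) (cS i)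
        (ω₀ i) (φ i) (hφ i) (hφb i) v ω hH
      exact ⟨K, hK, by rw [hadmK]; exact hHK⟩
    · rintro v K ⟨v', ω'⟩ hK h
      rw [hadmK] at h
      exact (S i).fst_eq_of_trace_mem_verticialSubgroups h36 hcoh c (hS i) (hSc i) (cS i) (ω₀ i) (φ i) (hφ i)
        h37 (hφb i) hK h
    · intro g x K hK h
      rw [hadmK] at h ⊢
      exact hVlaw g x K hK h
    · exact hVtr
    · rintro ⟨e, ω⟩
      obtain ⟨L, hL, h⟩ := (S i).exists_traceE_mem_edgeLikeSubgroups h36 hcoh c (hS i) (hSc i) (cS i) (ω₀ i)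
        (φ i) (hφ i) e ω
      exact ⟨L, hL, by rw [hadmK]; exact h⟩
    · rintro ⟨e, ω⟩ H hH
      obtain ⟨L, hL, hHL⟩ := (S i).exists_traceE_eq_of_mem_edgeLikeSubgroups h36 hcoh c (hS i) (hSc i) (cS i)
        (ω₀ i) (φ i) (hφ i) (hφb i) e ω hH
      exact ⟨L, hL, by rw [hadmK]; exact hHL⟩
    · rintro e L ⟨e', ω'⟩ hL h
      rw [hadmK] at h
      exact (S i).fst_eq_of_traceE_mem_edgeLikeSubgroups h36 hcoh c (hS i) (hSc i) (cS i) (ω₀ i) (φ i) (hφ i)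
        h37 hED (hφb i) hL h
    · intro g y L hL h
      rw [hadmK] at h ⊢
      exact hElaw g y L hL h
    · exact hEtr
    · intro n hn
      exact hρU n (by rw [hUN i]; exact hn)

/-- **The same over a FINITE coherent Thm-3.7 semi-graph of anabelioids, with NO further hypothesis** — the regime of
the special fibres of curves: strict coherence is automatic ([IUTchI] Rmk. 2.5.3 (i) (T3)) and Thm. 3.7 (iii) at `𝒢`
is a theorem for finite `𝒢` (`compactInVerticialAt_of_finiteGraph`). [cite: MochizukiSemiAnbd2006, Ex 3.10 p.44] -/
theorem exists_of_coverings_graphAction_of_finite [Finite 𝒢.graph.Vertex] [Finite 𝒢.graph.Edge]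
    (h37 : 𝒢.Thm37Hypotheses) (hcoh : 𝒢.IsCoherent) (c : TemperedPiChart 𝒢) (N : ℕ → Subgroup c.G)
    (hanti : Antitone N) (hopen : ∀ i, IsOpen (N i : Set c.G))
    (hchar : ∀ (i) (φ : c.G ≃ₜ* c.G), (N i).map φ.toMulEquiv.toMonoidHom = N i)
    (hnormal : ∀ i, (N i).Normal) (hfi : ∀ i, (N i).FiniteIndex) (hexh : ∀ g : c.G, (∀ i, g ∈ N i) → g = 1) :
    ∃ T : SpecialFibreTower c.G, T.N = N ∧ (∀ i, T.admKer i = ⊥) ∧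
      ∀ i, ∃ (S : CovObj 𝒢) (hS : S.IsTempered) (_ : T.Gc i = S.coveringGraph)
        (π : (T.Gc i).graph ⟶ 𝒢.graph) (ρ : c.G →* Aut (T.Gc i).graph),
        IsConnectedObj (⟨S, hS⟩ : BTempCat 𝒢) ∧ (∀ g, (ρ g).hom ≫ π = π) ∧
        Function.Surjective π.vertexMap ∧ Function.Surjective π.edgeMap ∧
        -- vertices: dictionary
        (∀ x, ∃ K ∈ verticialSubgroups c (π.vertexMap x),
          (K.subgroupOf (T.N i)).map (T.adm i).toMonoidHom ∈ verticialSubgroups (T.chart i) x) ∧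
        (∀ x (H : Subgroup (T.chart i).G), H ∈ verticialSubgroups (T.chart i) x →
          ∃ K ∈ verticialSubgroups c (π.vertexMap x), H = (K.subgroupOf (T.N i)).map (T.adm i).toMonoidHom) ∧
        (∀ (v : 𝒢.graph.Vertex) (K : Subgroup c.G) x, K ∈ verticialSubgroups c v →
          (K.subgroupOf (T.N i)).map (T.adm i).toMonoidHom ∈ verticialSubgroups (T.chart i) x →
          π.vertexMap x = v) ∧
        -- vertices: the action
        (∀ g x (K : Subgroup c.G), K ∈ verticialSubgroups c (π.vertexMap x) →
          (K.subgroupOf (T.N i)).map (T.adm i).toMonoidHom ∈ verticialSubgroups (T.chart i) x →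
          ((K.map (MulAut.conj g).toMonoidHom).subgroupOf (T.N i)).map (T.adm i).toMonoidHom ∈
            verticialSubgroups (T.chart i) ((ρ g).hom.vertexMap x)) ∧
        (∀ x₁ x₂, π.vertexMap x₁ = π.vertexMap x₂ → ∃ g, (ρ g).hom.vertexMap x₁ = x₂) ∧
        -- edges: dictionary
        (∀ y, ∃ L ∈ edgeLikeSubgroups c (π.edgeMap y),
          (L.subgroupOf (T.N i)).map (T.adm i).toMonoidHom ∈ edgeLikeSubgroups (T.chart i) y) ∧
        (∀ y (H : Subgroup (T.chart i).G), H ∈ edgeLikeSubgroups (T.chart i) y →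
          ∃ L ∈ edgeLikeSubgroups c (π.edgeMap y), H = (L.subgroupOf (T.N i)).map (T.adm i).toMonoidHom) ∧
        (∀ (e : 𝒢.graph.Edge) (L : Subgroup c.G) y, L ∈ edgeLikeSubgroups c e →
          (L.subgroupOf (T.N i)).map (T.adm i).toMonoidHom ∈ edgeLikeSubgroups (T.chart i) y → π.edgeMap y = e) ∧
        -- edges: the action
        (∀ g y (L : Subgroup c.G), L ∈ edgeLikeSubgroups c (π.edgeMap y) →
          (L.subgroupOf (T.N i)).map (T.adm i).toMonoidHom ∈ edgeLikeSubgroups (T.chart i) y →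
          ((L.map (MulAut.conj g).toMonoidHom).subgroupOf (T.N i)).map (T.adm i).toMonoidHom ∈
            edgeLikeSubgroups (T.chart i) ((ρ g).hom.edgeMap y)) ∧
        (∀ y₁ y₂, π.edgeMap y₁ = π.edgeMap y₂ → ∃ g, (ρ g).hom.edgeMap y₁ = y₂) ∧
        (∀ n ∈ T.N i, ρ n = 1) :=
  exists_of_coverings_graphAction h37 (isStrictlyCoherent_of_finite ⟨‹_›, ‹_›⟩ hcoh)
    compactInVerticialAt_of_finiteGraph c N hanti hopen hchar hnormal hfi hexh

end SpecialFibreTower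

end Literature.AnabelianGeometry.SemiGraphs

end
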